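import Mathlib
import HarnessLib
import HarnessLib.Audit
import Summits.AtomisticToContinuum.Crystallization.Statement
import Summits.AtomisticToContinuum.Crystallization.Theses.BrittleRungDescent
import Summits.AtomisticToContinuum.Crystallization.Theses.LaminarSixThreeThree
import Summits.AtomisticToContinuum.Crystallization.Theorems.MinMeanCycleStackingLockBasedDefectVanishCrystallizes
import Summits.AtomisticToContinuum.Crystallization.Theorems.ChargedEnergyGap.Negative.BlocksBound
import Literature.MathematicalPhysics.StatisticalMechanics.LennardJonesClusters

/-!
# Crux `LJBarlowRigidity` (stmt-AtomisticToContinuum-9206) — birth skeleton (BC3)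

Route `BrittleRungDescent`, sub-problem `Crystallization`, crux rank 4 (BARLOW-TRUSS RIGIDITY AT
`p = 6`, the Lennard-Jones end of the route's rigidity engine):

  `LJBarlowRigidity := H → Crystallization`, where `H` (the route's "LJ kissing balls" hypothesis,
  produced by the PROVED glue `LJKissingBalls` from `LocalHalesKernel` + `LJBondSpread`) says: for some
  scale `a > 0`, along every sequence of Lennard-Jones ground states, all but `o(N)` atoms `i` have a
  `4a`-ball in which EVERY atom is softly twelve-kissed at scale `a` (tolerance `1/400`, gap `1.26a`)
  with an fcc- or hcp-pattern soft contact graph on its shell; and `Crystallization =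
  HasPeriodicGroundStateEnergy lennardJones 3 ∧ IsCrystallizing lennardJones 3` (Blanc–Lewin).

## The line (three stubs = the route header's announced engine "BarlowTrussKorn →
## ActionReactionSurface → HaggFaultSelection", cut at the seams the tree can already glue)

* `stub_barlowWindows` — RIGIDITY HALF (discrete Korn on the octet truss): `H →` for all `R > 0`,
  `ε ∈ (0, 1/4)` and every LJ ground-state sequence, all but `o(N)` particles have their `R`-window
  two-way `ε`-matched (after `x ↦ x_i + A(· − z)`, `A` a linear isometry) to SOME Barlow stacking
  `barlowStacking a h s`, `a, h ∈ (1/2, 2)`, `s` any Hägg sequence.  The conclusion is VERBATIM the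
  signature of the open item `stmt-AtomisticToContinuum-14292`
  (`LaminarSixThreeThree.LaminarBarlowWindows`; also a registered stub of crux 12020), so this stub
  is `H →` that item and is discharged by name the day 14292 closes (`example` below).  Content
  proper to THIS crux: `H` hands over the 1/400-Barlow combinatorics in `4a`-balls a.e.; the proved
  `SoftLayerPropagation` (item 9210) + cell-wise rigidity of the tetrahedron–octahedron truss
  (Friesecke–James–Müller-type discrete Korn, uniform in the Hägg word) turn the `O(N^(2/3))` energy
  excess of ground states into `O(N^(2/3))` total squared strain, i.e. `ε`-rigid `R`-windows a.e.
* `stub_stackingSelection` — SELECTION HALF (action–reaction surface term + Hägg fault selection at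
  `p = 6`, two scales, based windows): `H →` there is ONE periodic `P` (intended: relaxed hcp, the
  polytype the LJ registry `J₂ ≈ −7.3e−5 < 0` with Hägg domination selects) such that for every
  target scale `(R, ε)` there is a certification scale `(R', ε')`, `0 < ε' < 1/4`, at which, along
  every LJ ground-state sequence, the particles that ARE Barlow-matched at `(R', ε')` but are NOT
  two-way `ε`-matched at radius `R` to a based window `x_i + A((P.points − p) ∩ B̄_R(p))`,
  `p ∈ P.points`, number `o(N)`.  (Unconditional form = the statement `LockedStackingSelection`
  registered on crux 12020; here weakened by the hypothesis `H`.)  Named below: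
  `TwoScaleStackingSelection`.
* `stub_energyFromWindows` — ENERGY IDENTIFICATION (the energetic conjunct is a CONSEQUENCE of based
  windows; new, potential-specific only through the proved LJ minimal distance and the `r⁻⁶` tail):
  for EVERY periodic `P`, if along every LJ ground-state sequence all but `o(N)` particles carry based
  `P`-windows at every scale `(R, ε)`, then `E(N)/N → e(P)`.  Mechanism: the energy is a sum of local
  energies `e_i = ½ Σ_j V(|x_i − x_j|)`, uniformly bounded on ground states (minimal distance
  `LennardJonesMinimalDistance_holds` + summable tail); inside one good `R`-window the matching is a
  local bijection for `2ε < δ`, so the local energies of the particles in the half-window sum to the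
  `P`-site energies of the matched points up to `O(ε) + O(R⁻³)` each, and site energies average to
  `e(P)` over large balls; bad particles and window rims are `o(N)`.  Hence `liminf E(N)/N ≥ e(P)`;
  with the tree's trial-state bound `limsup E(N)/N ≤ e(Q)` for every periodic `Q`
  (`ChargedEnergyGapNegative.limsup_div_le_energyPerParticle`, PROVED) the limit is `e(P)`.  Named
  below: `EnergyFromWindows`.  Size M–L, provable now; of independent use to every window-based route
  (it makes a periodic-minimiser crux such as `PeriodicReductionToBarlow` unnecessary once based
  windows are known).
* `LJBarlowRigidity_of : stub₁-sig → stub₂-sig → stub₃-sig → BrittleRungDescent.LJBarlowRigidity`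
  — the crux BY NAME, kernel-checked, no `sorry`: under `H`, take the `P` of the selection; the
  `(R, ε)`-bad set of the based-window predicate is covered by the non-Barlow particles at
  `(R', ε')` (stub 1) and the Barlow-but-not-`P` particles (stub 2) — union bound on `Nat.card` and a
  squeeze of densities (`natCard_not_le_add`, `tendsto_density_two_stage`, proved here); then
  (positional conjunct) the PROVED soft assembly lemma
  `MinMeanCycleStackingLockBasedDefectVanishCrystallizes.isCrystallizing_of_bulkDefectVanishBased`
  with `LennardJonesMinimalDistance_holds` gives `IsCrystallizing lennardJones 3`; (energetic
  conjunct) stub 3 gives `E(N)/N → e(P)` and the PROVED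
  `ChargedEnergyGapNegative.le_energyPerParticle_of_tendsto` gives `e(P) ≤ e(Q)` for every periodic
  `Q`, i.e. `IsLeast`, whence `HasPeriodicGroundStateEnergy lennardJones 3`.
* `LJBarlowRigidity_of_stubs : BrittleRungDescent.LJBarlowRigidity` — the crux from the three stubs
  (the only `sorry`s in its cone are the three `stub_*`).

`sorry` occurs only inside the three `stub_*` theorems.  The closing `example`s certify by-name
readings: item 14292's decl implies stub 1; the crux is literally `LocalBarlowOrder →
Crystallization`; the stub signatures are definitionally `LocalBarlowOrder → LaminarBarlowWindows`,
`LocalBarlowOrder → TwoScaleStackingSelection` and `EnergyFromWindows`.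

Disproof used: none on file for this crux (`ledger crux ls stmt-AtomisticToContinuum-9206`: no
workfiles before this one, 2026-08-17).  Negatives index (Crystallization entries 4146, 3506, 15929,
17253): 4146 (local Hales at tolerance 1/100) sits upstream of `H` and is avoided by the route's
1/400; 3506 (one-grain gluing, multiplicity-blind matching of ARBITRARY finite configurations) is not
an instance of any stub — all three quantify over LJ ground-state sequences (injective, uniformly
separated) and are `o(N)` density statements; 15929/17253 concern shell censuses / priced gaps, not
windows.
-/

namespace Summit.AtomisticToContinuum.Crystallization.Cruxes.LJBarlowRigidity.Birth

open Filter

/-! ## Generic counting glue (proved) -/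

/-- Union bound behind the two-scale assembly: a particle that is not `G`-good is either not
`B`-good, or `B`-good and not `G`-good. [folklore] -/
theorem natCard_not_le_add {N : ℕ} (B G : Fin N → Prop) :
    Nat.card {i : Fin N // ¬ G i} ≤
      Nat.card {i : Fin N // ¬ B i} + Nat.card {i : Fin N // B i ∧ ¬ G i} := by
  calc Nat.card {i : Fin N // ¬ G i} = ({i | ¬ G i} : Set (Fin N)).ncard := rfl
    _ ≤ ({i | ¬ B i} ∪ {i | B i ∧ ¬ G i} : Set (Fin N)).ncard := by
        refine Set.ncard_le_ncard (fun i hi => ?_)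
        simp only [Set.mem_setOf_eq, Set.mem_union] at hi ⊢
        by_cases hB : B i
        · exact Or.inr ⟨hB, hi⟩
        · exact Or.inl hB
    _ ≤ ({i | ¬ B i} : Set (Fin N)).ncard + ({i | B i ∧ ¬ G i} : Set (Fin N)).ncard :=
        Set.ncard_union_le _ _
    _ = Nat.card {i : Fin N // ¬ B i} + Nat.card {i : Fin N // B i ∧ ¬ G i} := rfl

/-- Two-stage density bound: if along `N → ∞` the density of particles that are not `B`-good and
the density of particles that are `B`-good but not `G`-good both tend to `0`, then the density of
particles that are not `G`-good tends to `0`. [folklore] -/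
theorem tendsto_density_two_stage (B G : (N : ℕ) → Fin N → Prop)
    (hB : Tendsto (fun N : ℕ => (Nat.card {i : Fin N // ¬ B N i} : ℝ) / N) atTop (nhds 0))
    (hBG : Tendsto (fun N : ℕ => (Nat.card {i : Fin N // B N i ∧ ¬ G N i} : ℝ) / N)
      atTop (nhds 0)) :
    Tendsto (fun N : ℕ => (Nat.card {i : Fin N // ¬ G N i} : ℝ) / N) atTop (nhds 0) := by
  have hsum : Tendsto (fun N : ℕ => (Nat.card {i : Fin N // ¬ B N i} : ℝ) / N +
      (Nat.card {i : Fin N // B N i ∧ ¬ G N i} : ℝ) / N) atTop (nhds 0) := by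
    simpa only [add_zero] using hB.add hBG
  refine squeeze_zero (fun N => by positivity) (fun N => ?_) hsum
  rw [← add_div]
  gcongr
  exact_mod_cast natCard_not_le_add (B N) (G N)

/-! ## Named statements (documentation of the inlined signatures) -/

/-- `H`, the hypothesis of the crux (`LJBarlowRigidity` is literally `LocalBarlowOrder →
Crystallization`, see the `example` at the end): for some scale `a > 0`, along every sequence of
Lennard-Jones ground states, all but `o(N)` atoms `i` have a `4a`-ball in which every atom is softly
twelve-kissed at scale `a` with tolerance `1/400` and gap `63/50·a` and has an fcc- or hcp-pattern
soft contact graph on its shell (verbatim the antecedent of the route decl). -/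
def LocalBarlowOrder : Prop :=
  (∃ a : ℝ, 0 < a ∧ ∀ x : (N : ℕ) → (Fin N → EuclideanSpace ℝ (Fin 3)), (∀ N, Literature.MathematicalPhysics.StatisticalMechanics.IsGroundState Literature.MathematicalPhysics.StatisticalMechanics.lennardJones (x N)) → Filter.Tendsto (fun N : ℕ => (Nat.card {i : Fin N // ¬ ∀ j : Fin N, dist (x N i) (x N j) ≤ 4 * a → (((∀ l : Fin N, l ≠ j → a * (1 - 1 / 400) ≤ dist (x N j) (x N l) ∧ (dist (x N j) (x N l) ≤ a * (1 + 1 / 400) ∨ 63 / 50 * a ≤ dist (x N j) (x N l))) ∧ Nat.card {l : Fin N // l ≠ j ∧ dist (x N j) (x N l) ≤ a * (1 + 1 / 400)} = 12) ∧ ((∃ e : {k : Fin N // k ≠ j ∧ dist (x N j) (x N k) ≤ a * (1 + 1 / 400)} ≃ {q : EuclideanSpace ℝ (Fin 3) // q ∈ Literature.Geometry.DiscreteGeometry.fccKissingPattern}, ∀ k k' : {k : Fin N // k ≠ j ∧ dist (x N j) (x N k) ≤ a * (1 + 1 / 400)}, k ≠ k' → (dist (x N k.1) (x N k'.1) ≤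 a * (1 + 1 / 400) ↔ dist (e k).1 (e k').1 = 1)) ∨ (∃ e : {k : Fin N // k ≠ j ∧ dist (x N j) (x N k) ≤ a * (1 + 1 / 400)} ≃ {q : EuclideanSpace ℝ (Fin 3) // q ∈ Literature.Geometry.DiscreteGeometry.hcpKissingPattern}, ∀ k k' : {k : Fin N // k ≠ j ∧ dist (x N j) (x N k) ≤ a * (1 + 1 / 400)}, k ≠ k' → (dist (x N k.1) (x N k'.1) ≤ a * (1 + 1 / 400) ↔ dist (e k).1 (e k').1 = 1))))} : ℝ) / N) Filter.atTop (nhds 0))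

/-- Statement of stub 2 without the hypothesis `H` — TWO-SCALE STACKING SELECTION (based
windows): ONE periodic `P` such that for every `(R, ε)` there are `(R', ε')`, `0 < ε' < 1/4`, with:
along every LJ ground-state sequence the particles Barlow-matched at `(R', ε')` but not `P`-matched
at `(R, ε)` number `o(N)`.  (Verbatim the statement `LockedStackingSelection` registered on crux
stmt-AtomisticToContinuum-12020; stub 2 is `LocalBarlowOrder → TwoScaleStackingSelection`.) -/
def TwoScaleStackingSelection : Prop :=
  ∃ P : Literature.MathematicalPhysics.StatisticalMechanics.PeriodicConfiguration 3, ∀ R ε : ℝ, 0 < R → 0 < ε → ∃ R' ε' : ℝ, 0 < R' ∧ 0 < ε' ∧ ε' < 1 / 4 ∧ ∀ x : (N : ℕ) → (Fin N → EuclideanSpace ℝ (Fin 3)), (∀ N, Literature.MathematicalPhysics.StatisticalMechanics.IsGroundState Literature.MathematicalPhysics.StatisticalMechanics.lennardJones (x N)) → Filter.Tendsto (fun N : ℕ => (Nat.card {i : Fin N // (∃ a h : ℝ, 1 / 2 < a ∧ a < 2 ∧ 1 / 2 < h ∧ h < 2 ∧ ∃ s : ℤ → ℤ, Literature.MathematicalPhysics.StatisticalMechanics.IsHaggSeq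 s ∧ ∃ z ∈ Literature.MathematicalPhysics.StatisticalMechanics.barlowStacking a h s, ∃ A : EuclideanSpace ℝ (Fin 3) →ₗᵢ[ℝ] EuclideanSpace ℝ (Fin 3), (∀ p ∈ Literature.MathematicalPhysics.StatisticalMechanics.barlowStacking a h s, dist p z ≤ R' → ∃ j : Fin N, dist (x N j) (x N i + A (p - z)) ≤ ε') ∧ (∀ j : Fin N, dist (x N j) (x N i) ≤ R' → ∃ p ∈ Literature.MathematicalPhysics.StatisticalMechanics.barlowStacking a h s, dist (x N j) (x N i + A (p - z)) ≤ ε')) ∧ ¬ (∃ A : EuclideanSpace ℝ (Fin 3) →ₗᵢ[ℝ] EuclideanSpace ℝ (Fin 3), ∃ p ∈ P.points, (∀ q ∈ P.points, dist q p ≤ R → ∃ j : Fin N, dist (x N j) (x N i + A (q - p)) ≤ ε) ∧ (∀ j : Fin N, dist (x N j) (x N i) ≤ R → ∃ q ∈ P.points, dist (x N j) (x N i + A (q - p)) ≤ ε))} : ℝ) / N) Filter.atTop (nhds 0)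

/-- Statement of stub 3 — ENERGY IDENTIFICATION FROM BASED WINDOWS: for every periodic `P`, if
along every sequence of Lennard-Jones ground states all but `o(N)` particles carry, at every scale
`(R, ε)`, an `R`-window two-way `ε`-matched to a based window `x_i + A((P.points − p) ∩ B̄_R(p))`
of `P`, then the ground-state energy per particle converges to `e(P)`. -/
def EnergyFromWindows : Prop :=
  ∀ P : Literature.MathematicalPhysics.StatisticalMechanics.PeriodicConfiguration 3, (∀ R ε : ℝ, 0 < R → 0 < ε → ∀ x : (N : ℕ) → (Fin N → EuclideanSpace ℝ (Fin 3)), (∀ N, Literature.MathematicalPhysics.StatisticalMechanics.IsGroundState Literature.MathematicalPhysics.StatisticalMechanics.lennardJones (x N)) → Filter.Tendsto (fun N : ℕ => (Nat.card {i : Fin N // ¬ ∃ A : EuclideanSpace ℝ (Fin 3) →ₗᵢ[ℝ] EuclideanSpace ℝ (Fin 3), ∃ p ∈ P.points, (∀ q ∈ P.points, dist q p ≤ R → ∃ j : Fin N, dist (x N j) (x N i + A (q - p)) ≤ ε) ∧ (∀ j : Fin N, dist (x N j) (x N i) ≤ R → ∃ q ∈ P.points, dist (x N j) (x N i + A (q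 - p)) ≤ ε)} : ℝ) / N) Filter.atTop (nhds 0)) → Filter.Tendsto (fun N : ℕ => Literature.MathematicalPhysics.StatisticalMechanics.groundStateEnergy Literature.MathematicalPhysics.StatisticalMechanics.lennardJones 3 N / N) Filter.atTop (nhds (P.energyPerParticle Literature.MathematicalPhysics.StatisticalMechanics.lennardJones))

/-! ## The stubs -/

/-- **Stub 1 — rigidity half (`H →` LAMINAR BARLOW WINDOWS).**  Under the crux hypothesis `H`
(a.e. `4a`-balls of softly twelve-kissed atoms with fcc/hcp shell graphs, tolerance `1/400`), for
all `R > 0`, `ε ∈ (0, 1/4)` and every LJ ground-state sequence, the fraction of particles whose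
`R`-window is NOT two-way `ε`-matched to some `barlowStacking a h s` (`a, h ∈ (1/2, 2)`, `s` Hägg)
tends to `0`.  Conclusion VERBATIM item stmt-AtomisticToContinuum-14292
(`LaminarSixThreeThree.LaminarBarlowWindows`), so the stub is `H → 14292` (weaker than 14292).
Why plausibly true: `H` fixes the local combinatorics (octet-truss bond graph off an `o(N)` set;
proved `SoftLayerPropagation`, item 9210, for the qualitative chart), and the total energy excess of
a ground state over `N·e*` is `O(N^(2/3))` (trial states, `limsup_div_le_energyPerParticle`, vs.
`N·e* ≤ E`, `card_mul_eStar_le`, both PROVED), so a discrete Korn inequality on the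
tetrahedron–octahedron truss (uniform in the Hägg word) leaves `O(N^(2/3))` squared strain: all but
`o(N)` `R`-windows are `ε`-rigid, i.e. Barlow-matched; the LJ bulk bond `≈ 0.97` puts `a, h` in
`(1/2, 2)`.  Fails iff strain does not average out at `p = 6` (the `r⁻⁶` tail Hessian against the
octet-truss Korn constant) — the crux's own why-might-fail.  Size: XL.  Leans on:
`SoftLayerPropagation` (9210, proved), `LennardJonesMinimalDistance_holds`,
`ChargedEnergyGapNegative.limsup_div_le_energyPerParticle` / `card_mul_eStar_le` (proved),
FrieseckeJamesMuller2002 (discrete Korn, to be built). -/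
theorem stub_barlowWindows : (∃ a : ℝ, 0 < a ∧ ∀ x : (N : ℕ) → (Fin N → EuclideanSpace ℝ (Fin 3)), (∀ N, Literature.MathematicalPhysics.StatisticalMechanics.IsGroundState Literature.MathematicalPhysics.StatisticalMechanics.lennardJones (x N)) → Filter.Tendsto (fun N : ℕ => (Nat.card {i : Fin N // ¬ ∀ j : Fin N, dist (x N i) (x N j) ≤ 4 * a → (((∀ l : Fin N, l ≠ j → a * (1 - 1 / 400) ≤ dist (x N j) (x N l) ∧ (dist (x N j) (x N l) ≤ a * (1 + 1 / 400) ∨ 63 / 50 * a ≤ dist (x N j) (x N l))) ∧ Nat.card {l : Fin N // l ≠ j ∧ dist (x N j) (x N l) ≤ a * (1 + 1 / 400)} = 12) ∧ ((∃ e : {k : Fin N // k ≠ j ∧ dist (x N j) (x N k) ≤ a * (1 + 1 / 400)} ≃ {q : EuclideanSpace ℝ (Fin 3) // q ∈ Literature.Geometry.DiscreteGeometry.fccKissingPattern}, ∀ k k' : {k : Fin N // k ≠ j ∧ dist (x N j) (x N k) ≤ a * (1 + 1 / 400)}, k ≠ k' → (dist (x N k.1) (x N k'.1) ≤ a * (1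 + 1 / 400) ↔ dist (e k).1 (e k').1 = 1)) ∨ (∃ e : {k : Fin N // k ≠ j ∧ dist (x N j) (x N k) ≤ a * (1 + 1 / 400)} ≃ {q : EuclideanSpace ℝ (Fin 3) // q ∈ Literature.Geometry.DiscreteGeometry.hcpKissingPattern}, ∀ k k' : {k : Fin N // k ≠ j ∧ dist (x N j) (x N k) ≤ a * (1 + 1 / 400)}, k ≠ k' → (dist (x N k.1) (x N k'.1) ≤ a * (1 + 1 / 400) ↔ dist (e k).1 (e k').1 = 1))))} : ℝ) / N) Filter.atTop (nhds 0)) → ∀ R ε : ℝ, 0 < R → 0 < ε → ε < 1 / 4 → ∀ x : (N : ℕ) → (Fin N → EuclideanSpace ℝ (Fin 3)), (∀ N, Literature.MathematicalPhysics.StatisticalMechanics.IsGroundState Literature.MathematicalPhysics.StatisticalMechanics.lennardJones (x N)) → Filter.Tendsto (fun N : ℕ => (Nat.card {i : Fin N // ¬ (∃ a h : ℝ, 1 / 2 < a ∧ a < 2 ∧ 1 / 2 < h ∧ h < 2 ∧ ∃ s : ℤ → ℤ, Literature.MathematicalPhysics.StatisticalMechanics.IsHaggSeq s ∧ ∃ z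 ∈ Literature.MathematicalPhysics.StatisticalMechanics.barlowStacking a h s, ∃ A : EuclideanSpace ℝ (Fin 3) →ₗᵢ[ℝ] EuclideanSpace ℝ (Fin 3), (∀ p ∈ Literature.MathematicalPhysics.StatisticalMechanics.barlowStacking a h s, dist p z ≤ R → ∃ j : Fin N, dist (x N j) (x N i + A (p - z)) ≤ ε) ∧ (∀ j : Fin N, dist (x N j) (x N i) ≤ R → ∃ p ∈ Literature.MathematicalPhysics.StatisticalMechanics.barlowStacking a h s, dist (x N j) (x N i + A (p - z)) ≤ ε))} : ℝ) / N) Filter.atTop (nhds 0) := by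
  sorry

/-- **Stub 2 — selection half (`H →` TWO-SCALE STACKING SELECTION, based windows).**  Under `H`
there is ONE periodic configuration `P` of `ℝ³` such that for every window radius `R > 0` and
tolerance `ε > 0` there are a certification radius `R' > 0` and tolerance `ε' ∈ (0, 1/4)` such
that, along every LJ ground-state sequence, the fraction of particles whose `R'`-window IS two-way
`ε'`-matched to some Barlow stacking (`a, h ∈ (1/2, 2)`, any Hägg sequence) but whose `R`-window is
NOT two-way `ε`-matched to a based window of `P` tends to `0`.  Why plausibly true (the route's
engine at `p = 6`): (i) parameter selection — a Barlow-matched bulk grain at `(a, h)` off the relaxed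
optimum `(a*, h*)` by `δ` costs `≳ δ²` per particle (strict second-order stability of the relaxed
close-packed LJ lattice sums) against the `O(N^(2/3))` surface budget, so `δ ≲ N^(−1/6) → 0` and for
fixed `(R, ε)` eventually `δ·R < ε`; (ii) stacking selection — the linear term of `Σ V_LJ` around
the relaxed stacking is a boundary functional of balanced internal forces (action–reaction), and
every faulted `K`-window of the local Hägg word costs at least the fault price `|J₂| − 2·tail > 0`
(`J₂ ≈ −7.3e−5`, Hägg domination ratio ≈ 250–450 at `p = 6`; certified couplings are item 0670,
the Peierls form is the PROVED `LockedPhaseDefectBound`, item 12024) per unit layer area against the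
same budget ⇒ `O(N^(2/3))` faulted `R`-windows; witness `P :=` relaxed hcp
(`barlowPeriodicConfiguration` of the period-2 word), `R' ≫ R`, `ε' ≪ ε/R`.  Fails iff hcp/fcc
selection does not happen INSIDE finite LJ ground states (elastic noise per atom `~2e−5` vs. the
stacking gap `7e−5`: fcc-like or densely twinned minimisers for all large `N`) — the crux's declared
why-might-fail (PartayOrtnerCsanyi2017; ShortRangeStackingBlindness respected: all ranges kept).
Size: XL.  Leans on: `LockedPhaseDefectBound` (12024, proved), item 0670 (certified `J_k`),
`HaggStacking`/`BarlowStackingEnergy` (tree), `LennardJonesMinimalDistance_holds`. -/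
theorem stub_stackingSelection : (∃ a : ℝ, 0 < a ∧ ∀ x : (N : ℕ) → (Fin N → EuclideanSpace ℝ (Fin 3)), (∀ N, Literature.MathematicalPhysics.StatisticalMechanics.IsGroundState Literature.MathematicalPhysics.StatisticalMechanics.lennardJones (x N)) → Filter.Tendsto (fun N : ℕ => (Nat.card {i : Fin N // ¬ ∀ j : Fin N, dist (x N i) (x N j) ≤ 4 * a → (((∀ l : Fin N, l ≠ j → a * (1 - 1 / 400) ≤ dist (x N j) (x N l) ∧ (dist (x N j) (x N l) ≤ a * (1 + 1 / 400) ∨ 63 / 50 * a ≤ dist (x N j) (x N l))) ∧ Nat.card {l : Fin N // l ≠ j ∧ dist (x N j) (x N l) ≤ a * (1 + 1 / 400)} = 12) ∧ ((∃ e : {k : Fin N // k ≠ j ∧ dist (x N j) (x N k) ≤ a * (1 + 1 / 400)} ≃ {q : EuclideanSpace ℝ (Fin 3) // q ∈ Literature.Geometry.DiscreteGeometry.fccKissingPattern}, ∀ k k' : {k : Fin N // k ≠ j ∧ dist (x N j) (x N k) ≤ a * (1 + 1 / 400)}, k ≠ k' → (dist (x N k.1) (x N k'.1) ≤ a * (1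 + 1 / 400) ↔ dist (e k).1 (e k').1 = 1)) ∨ (∃ e : {k : Fin N // k ≠ j ∧ dist (x N j) (x N k) ≤ a * (1 + 1 / 400)} ≃ {q : EuclideanSpace ℝ (Fin 3) // q ∈ Literature.Geometry.DiscreteGeometry.hcpKissingPattern}, ∀ k k' : {k : Fin N // k ≠ j ∧ dist (x N j) (x N k) ≤ a * (1 + 1 / 400)}, k ≠ k' → (dist (x N k.1) (x N k'.1) ≤ a * (1 + 1 / 400) ↔ dist (e k).1 (e k').1 = 1))))} : ℝ) / N) Filter.atTop (nhds 0)) → ∃ P : Literature.MathematicalPhysics.StatisticalMechanics.PeriodicConfiguration 3, ∀ R ε : ℝ, 0 < R → 0 < ε → ∃ R' ε' : ℝ, 0 < R' ∧ 0 < ε' ∧ ε' < 1 / 4 ∧ ∀ x : (N : ℕ) → (Fin N → EuclideanSpace ℝ (Fin 3)), (∀ N, Literature.MathematicalPhysics.StatisticalMechanics.IsGroundState Literature.MathematicalPhysics.StatisticalMechanics.lennardJones (x N)) → Filter.Tendsto (fun N : ℕ => (Nat.card {i : Fin N // (∃ a h : ℝ, 1 / 2 < a ∧ a < 2 ∧ 1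 / 2 < h ∧ h < 2 ∧ ∃ s : ℤ → ℤ, Literature.MathematicalPhysics.StatisticalMechanics.IsHaggSeq s ∧ ∃ z ∈ Literature.MathematicalPhysics.StatisticalMechanics.barlowStacking a h s, ∃ A : EuclideanSpace ℝ (Fin 3) →ₗᵢ[ℝ] EuclideanSpace ℝ (Fin 3), (∀ p ∈ Literature.MathematicalPhysics.StatisticalMechanics.barlowStacking a h s, dist p z ≤ R' → ∃ j : Fin N, dist (x N j) (x N i + A (p - z)) ≤ ε') ∧ (∀ j : Fin N, dist (x N j) (x N i) ≤ R' → ∃ p ∈ Literature.MathematicalPhysics.StatisticalMechanics.barlowStacking a h s, dist (x N j) (x N i + A (p - z)) ≤ ε')) ∧ ¬ (∃ A : EuclideanSpace ℝ (Fin 3) →ₗᵢ[ℝ] EuclideanSpace ℝ (Fin 3), ∃ p ∈ P.points, (∀ q ∈ P.points, dist q p ≤ R → ∃ j : Fin N, dist (x N j) (x N i + A (q - p)) ≤ ε) ∧ (∀ j : Fin N, dist (x N j) (x N i) ≤ R → ∃ q ∈ P.points, dist (x N j) (x N i + A (q - p)) ≤ ε))} : ℝ) / N) Filter.atTop (nhds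 0) := by
  sorry

/-- **Stub 3 — energy identification from based windows** (the statement `EnergyFromWindows`,
inlined).  For every periodic `P`: if along every LJ ground-state sequence all but `o(N)` particles
carry based `P`-windows at every scale, then `E(N)/N → e(P)`.  Why plausibly true: local energies
`e_i = ½ Σ_(j ≠ i) V_LJ(|x_i − x_j|)` are uniformly bounded on ground states (minimal distance `δ`,
PROVED, + `r⁻⁶` tail); in a good `R`-window with `2ε < δ` the matching `j ↦ q_j` is injective and
exhausts `P.points ∩ B(p, R − ε)`, so `Σ_(j ∈ B(x_i, R/4)) e_j = Σ_(q ∈ P.points ∩ B(p, R/4))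
site_P(q) + #·O(ε + R⁻³)`, and `P`-site energies average to `e(P)` over large balls (finite motif,
lattice periodicity; the `tsum` in `energyPerParticle` is absolutely convergent for LJ, tree
`PeriodicConfigurationSums`/`Blocks`); covering the cluster by such quarter-windows off an `o(N)`
set gives `E(N) ≥ N·e(P) − o(N)`, and `limsup E(N)/N ≤ e(P)` is the PROVED trial-state bound.
If no LJ ground-state sequence is `P`-windowed the hypothesis is false and the instance is vacuous;
if it holds, `e(P)` is forced to be `e* = lim E(N)/N` (`CrysEnergyLimit_holds`), consistently for
all such `P`.  Size: M–L, provable now.  Leans on: `LennardJonesMinimalDistance_holds`,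
`ChargedEnergyGapNegative.limsup_div_le_energyPerParticle`, `Blocks.*` periodic bookkeeping,
`BlancLewin2015_8_holds`. -/
theorem stub_energyFromWindows : ∀ P : Literature.MathematicalPhysics.StatisticalMechanics.PeriodicConfiguration 3, (∀ R ε : ℝ, 0 < R → 0 < ε → ∀ x : (N : ℕ) → (Fin N → EuclideanSpace ℝ (Fin 3)), (∀ N, Literature.MathematicalPhysics.StatisticalMechanics.IsGroundState Literature.MathematicalPhysics.StatisticalMechanics.lennardJones (x N)) → Filter.Tendsto (fun N : ℕ => (Nat.card {i : Fin N // ¬ ∃ A : EuclideanSpace ℝ (Fin 3) →ₗᵢ[ℝ] EuclideanSpace ℝ (Fin 3), ∃ p ∈ P.points, (∀ q ∈ P.points, dist q p ≤ R → ∃ j : Fin N, dist (x N j) (x N i + A (q - p)) ≤ ε) ∧ (∀ j : Fin N, dist (x N j) (x N i) ≤ R → ∃ q ∈ P.points, dist (x N j) (x N i + A (q - p)) ≤ ε)} : ℝ) / N) Filter.atTop (nhds 0)) → Filter.Tendsto (fun N : ℕ => Literature.MathematicalPhysics.StatisticalMechanics.groundStateEnergy Literature.MathematicalPhysics.StatisticalMechanics.lennardJones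 3 N / N) Filter.atTop (nhds (P.energyPerParticle Literature.MathematicalPhysics.StatisticalMechanics.lennardJones)) := by
  sorry

/-! ## The composition (kernel-checked, no sorry) -/

/-- **The crux BY NAME from the three stub signatures** (real proof): under `H` take the `P` of the
two-scale selection (stub 2); by the union bound `natCard_not_le_add` / `tendsto_density_two_stage`
with the laminar Barlow windows (stub 1) every `(R, ε)`-based-window defect set has density `→ 0`;
the PROVED soft assembly lemma `isCrystallizing_of_bulkDefectVanishBased` (route
MinMeanCycleStackingLock, item 12025) with `LennardJonesMinimalDistance_holds` gives
`IsCrystallizing lennardJones 3`; stub 3 gives `E(N)/N → e(P)` and the PROVED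
`le_energyPerParticle_of_tendsto` gives `e(P) ≤ e(Q)` for all periodic `Q` (`IsLeast`), so
`HasPeriodicGroundStateEnergy lennardJones 3`; together `Crystallization`. -/
theorem LJBarlowRigidity_of : ((∃ a : ℝ, 0 < a ∧ ∀ x : (N : ℕ) → (Fin N → EuclideanSpace ℝ (Fin 3)), (∀ N, Literature.MathematicalPhysics.StatisticalMechanics.IsGroundState Literature.MathematicalPhysics.StatisticalMechanics.lennardJones (x N)) → Filter.Tendsto (fun N : ℕ => (Nat.card {i : Fin N // ¬ ∀ j : Fin N, dist (x N i) (x N j) ≤ 4 * a → (((∀ l : Fin N, l ≠ j → a * (1 - 1 / 400) ≤ dist (x N j) (x N l) ∧ (dist (x N j) (x N l) ≤ a * (1 + 1 / 400) ∨ 63 / 50 * a ≤ dist (x N j) (x N l))) ∧ Nat.card {l : Fin N // l ≠ j ∧ dist (x N j) (x N l) ≤ a * (1 + 1 / 400)} = 12) ∧ ((∃ e : {k : Fin N // k ≠ j ∧ dist (x N j) (x N k) ≤ a * (1 + 1 / 400)} ≃ {q : EuclideanSpace ℝ (Fin 3) // q ∈ Literature.Geometry.DiscreteGeometry.fccKissingPattern},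 ∀ k k' : {k : Fin N // k ≠ j ∧ dist (x N j) (x N k) ≤ a * (1 + 1 / 400)}, k ≠ k' → (dist (x N k.1) (x N k'.1) ≤ a * (1 + 1 / 400) ↔ dist (e k).1 (e k').1 = 1)) ∨ (∃ e : {k : Fin N // k ≠ j ∧ dist (x N j) (x N k) ≤ a * (1 + 1 / 400)} ≃ {q : EuclideanSpace ℝ (Fin 3) // q ∈ Literature.Geometry.DiscreteGeometry.hcpKissingPattern}, ∀ k k' : {k : Fin N // k ≠ j ∧ dist (x N j) (x N k) ≤ a * (1 + 1 / 400)}, k ≠ k' → (dist (x N k.1) (x N k'.1) ≤ a * (1 + 1 / 400) ↔ dist (e k).1 (e k').1 = 1))))} : ℝ) / N) Filter.atTop (nhds 0)) → ∀ R ε : ℝ, 0 < R → 0 < ε → ε < 1 / 4 → ∀ x : (N : ℕ) → (Fin N → EuclideanSpace ℝ (Fin 3)), (∀ N, Literature.MathematicalPhysics.StatisticalMechanics.IsGroundState Literature.MathematicalPhysics.StatisticalMechanics.lennardJones (x N)) → Filter.Tendsto (fun N : ℕ => (Nat.card {i : Fin N // ¬ (∃ a h : ℝ, 1 / 2 < a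 ∧ a < 2 ∧ 1 / 2 < h ∧ h < 2 ∧ ∃ s : ℤ → ℤ, Literature.MathematicalPhysics.StatisticalMechanics.IsHaggSeq s ∧ ∃ z ∈ Literature.MathematicalPhysics.StatisticalMechanics.barlowStacking a h s, ∃ A : EuclideanSpace ℝ (Fin 3) →ₗᵢ[ℝ] EuclideanSpace ℝ (Fin 3), (∀ p ∈ Literature.MathematicalPhysics.StatisticalMechanics.barlowStacking a h s, dist p z ≤ R → ∃ j : Fin N, dist (x N j) (x N i + A (p - z)) ≤ ε) ∧ (∀ j : Fin N, dist (x N j) (x N i) ≤ R → ∃ p ∈ Literature.MathematicalPhysics.StatisticalMechanics.barlowStacking a h s, dist (x N j) (x N i + A (p - z)) ≤ ε))} : ℝ) / N) Filter.atTop (nhds 0)) → ((∃ a : ℝ, 0 < a ∧ ∀ x : (N : ℕ) → (Fin N → EuclideanSpace ℝ (Fin 3)), (∀ N, Literature.MathematicalPhysics.StatisticalMechanics.IsGroundState Literature.MathematicalPhysics.StatisticalMechanics.lennardJones (x N)) → Filter.Tendsto (fun N : ℕ => (Nat.card {i : Fin N // ¬ ∀ j : Fin N, dist (x N i) (x N j)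 ≤ 4 * a → (((∀ l : Fin N, l ≠ j → a * (1 - 1 / 400) ≤ dist (x N j) (x N l) ∧ (dist (x N j) (x N l) ≤ a * (1 + 1 / 400) ∨ 63 / 50 * a ≤ dist (x N j) (x N l))) ∧ Nat.card {l : Fin N // l ≠ j ∧ dist (x N j) (x N l) ≤ a * (1 + 1 / 400)} = 12) ∧ ((∃ e : {k : Fin N // k ≠ j ∧ dist (x N j) (x N k) ≤ a * (1 + 1 / 400)} ≃ {q : EuclideanSpace ℝ (Fin 3) // q ∈ Literature.Geometry.DiscreteGeometry.fccKissingPattern}, ∀ k k' : {k : Fin N // k ≠ j ∧ dist (x N j) (x N k) ≤ a * (1 + 1 / 400)}, k ≠ k' → (dist (x N k.1) (x N k'.1) ≤ a * (1 + 1 / 400) ↔ dist (e k).1 (e k').1 = 1)) ∨ (∃ e : {k : Fin N // k ≠ j ∧ dist (x N j) (x N k) ≤ a * (1 + 1 / 400)} ≃ {q : EuclideanSpace ℝ (Fin 3) // q ∈ Literature.Geometry.DiscreteGeometry.hcpKissingPattern}, ∀ k k' : {k : Fin N // k ≠ j ∧ dist (x N j) (x N k) ≤ a * (1 + 1 / 400)},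 k ≠ k' → (dist (x N k.1) (x N k'.1) ≤ a * (1 + 1 / 400) ↔ dist (e k).1 (e k').1 = 1))))} : ℝ) / N) Filter.atTop (nhds 0)) → ∃ P : Literature.MathematicalPhysics.StatisticalMechanics.PeriodicConfiguration 3, ∀ R ε : ℝ, 0 < R → 0 < ε → ∃ R' ε' : ℝ, 0 < R' ∧ 0 < ε' ∧ ε' < 1 / 4 ∧ ∀ x : (N : ℕ) → (Fin N → EuclideanSpace ℝ (Fin 3)), (∀ N, Literature.MathematicalPhysics.StatisticalMechanics.IsGroundState Literature.MathematicalPhysics.StatisticalMechanics.lennardJones (x N)) → Filter.Tendsto (fun N : ℕ => (Nat.card {i : Fin N // (∃ a h : ℝ, 1 / 2 < a ∧ a < 2 ∧ 1 / 2 < h ∧ h < 2 ∧ ∃ s : ℤ → ℤ, Literature.MathematicalPhysics.StatisticalMechanics.IsHaggSeq s ∧ ∃ z ∈ Literature.MathematicalPhysics.StatisticalMechanics.barlowStacking a h s, ∃ A : EuclideanSpace ℝ (Fin 3) →ₗᵢ[ℝ] EuclideanSpace ℝ (Fin 3), (∀ p ∈ Literature.MathematicalPhysics.StatisticalMechanics.barlowStacking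 a h s, dist p z ≤ R' → ∃ j : Fin N, dist (x N j) (x N i + A (p - z)) ≤ ε') ∧ (∀ j : Fin N, dist (x N j) (x N i) ≤ R' → ∃ p ∈ Literature.MathematicalPhysics.StatisticalMechanics.barlowStacking a h s, dist (x N j) (x N i + A (p - z)) ≤ ε')) ∧ ¬ (∃ A : EuclideanSpace ℝ (Fin 3) →ₗᵢ[ℝ] EuclideanSpace ℝ (Fin 3), ∃ p ∈ P.points, (∀ q ∈ P.points, dist q p ≤ R → ∃ j : Fin N, dist (x N j) (x N i + A (q - p)) ≤ ε) ∧ (∀ j : Fin N, dist (x N j) (x N i) ≤ R → ∃ q ∈ P.points, dist (x N j) (x N i + A (q - p)) ≤ ε))} : ℝ) / N) Filter.atTop (nhds 0)) → (∀ P : Literature.MathematicalPhysics.StatisticalMechanics.PeriodicConfiguration 3, (∀ R ε : ℝ, 0 < R → 0 < ε → ∀ x : (N : ℕ) → (Fin N → EuclideanSpace ℝ (Fin 3)), (∀ N, Literature.MathematicalPhysics.StatisticalMechanics.IsGroundState Literature.MathematicalPhysics.StatisticalMechanics.lennardJones (x N)) → Filter.Tendsto (fun N : ℕ => (Nat.card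 {i : Fin N // ¬ ∃ A : EuclideanSpace ℝ (Fin 3) →ₗᵢ[ℝ] EuclideanSpace ℝ (Fin 3), ∃ p ∈ P.points, (∀ q ∈ P.points, dist q p ≤ R → ∃ j : Fin N, dist (x N j) (x N i + A (q - p)) ≤ ε) ∧ (∀ j : Fin N, dist (x N j) (x N i) ≤ R → ∃ q ∈ P.points, dist (x N j) (x N i + A (q - p)) ≤ ε)} : ℝ) / N) Filter.atTop (nhds 0)) → Filter.Tendsto (fun N : ℕ => Literature.MathematicalPhysics.StatisticalMechanics.groundStateEnergy Literature.MathematicalPhysics.StatisticalMechanics.lennardJones 3 N / N) Filter.atTop (nhds (P.energyPerParticle Literature.MathematicalPhysics.StatisticalMechanics.lennardJones))) → Summit.AtomisticToContinuum.Crystallization.Theses.BrittleRungDescent.LJBarlowRigidity := by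
  intro h1 h2 h3
  unfold Summit.AtomisticToContinuum.Crystallization.Theses.BrittleRungDescent.LJBarlowRigidity
  intro hH
  obtain ⟨P, hP⟩ := h2 hH
  -- based `P`-windows at every scale: union bound over the two-scale selection
  have hBDV : ∀ R ε : ℝ, 0 < R → 0 < ε → ∀ x : (N : ℕ) → (Fin N → EuclideanSpace ℝ (Fin 3)), (∀ N, Literature.MathematicalPhysics.StatisticalMechanics.IsGroundState Literature.MathematicalPhysics.StatisticalMechanics.lennardJones (x N)) → Filter.Tendsto (fun N : ℕ => (Nat.card {i : Fin N // ¬ ∃ A : EuclideanSpace ℝ (Fin 3) →ₗᵢ[ℝ] EuclideanSpace ℝ (Fin 3), ∃ p ∈ P.points, (∀ q ∈ P.points, dist q p ≤ R → ∃ j : Fin N, dist (x N j) (x N i + A (q - p)) ≤ ε) ∧ (∀ j : Fin N, dist (x N j) (x N i) ≤ R → ∃ q ∈ P.points, dist (x N j) (x N i + A (q - p)) ≤ ε)} : ℝ) / N) Filter.atTop (nhds 0) := by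
    intro R ε hR hε x hx
    obtain ⟨R', ε', hR', hε', hε'4, hsel⟩ := hP R ε hR hε
    exact tendsto_density_two_stage _ _ (h1 hH R' ε' hR' hε' hε'4 x hx) (hsel x hx)
  -- positional conjunct: soft assembly lemma (proved) + LJ minimal distance (proved)
  obtain ⟨δ, hδ, hsep⟩ := (Literature.MathematicalPhysics.StatisticalMechanics.LennardJonesMinimalDistance_holds :
    ∃ δ : ℝ, 0 < δ ∧ ∀ (N : ℕ) (x : Fin N → EuclideanSpace ℝ (Fin 3)),
      Literature.MathematicalPhysics.StatisticalMechanics.IsGroundState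
        Literature.MathematicalPhysics.StatisticalMechanics.lennardJones x → ∀ i j, i ≠ j → δ ≤ dist (x i) (x j))
  have hpos : Literature.MathematicalPhysics.StatisticalMechanics.IsCrystallizing
      Literature.MathematicalPhysics.StatisticalMechanics.lennardJones 3 :=
    Summit.AtomisticToContinuum.Crystallization.Theorems.MinMeanCycleStackingLockBasedDefectVanishCrystallizes.isCrystallizing_of_bulkDefectVanishBased
      P hBDV hδ hsep
  -- energetic conjunct: E(N)/N → e(P) (stub 3) and e(P) ≤ e(Q) for every periodic Q (proved)
  have htend : Filter.Tendsto (fun N : ℕ => Literature.MathematicalPhysics.StatisticalMechanics.groundStateEnergy Literature.MathematicalPhysics.StatisticalMechanics.lennardJones 3 N / N) Filter.atTop (nhds (P.energyPerParticle Literature.MathematicalPhysics.StatisticalMechanics.lennardJones)) := h3 P hBDV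
  have hleast : IsLeast (Set.range fun Q : Literature.MathematicalPhysics.StatisticalMechanics.PeriodicConfiguration 3 =>
      Q.energyPerParticle Literature.MathematicalPhysics.StatisticalMechanics.lennardJones)
      (P.energyPerParticle Literature.MathematicalPhysics.StatisticalMechanics.lennardJones) := by
    refine ⟨⟨P, rfl⟩, ?_⟩
    rintro _ ⟨Q, rfl⟩
    exact Summit.AtomisticToContinuum.Crystallization.Theorems.ChargedEnergyGapNegative.le_energyPerParticle_of_tendsto htend Q
  exact ⟨⟨P, hleast, htend⟩, hpos⟩

/-- **The crux from the three stubs** (type literally the route decl; the only `sorry`s in its cone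
are `stub_barlowWindows`, `stub_stackingSelection`, `stub_energyFromWindows`). -/
theorem LJBarlowRigidity_of_stubs : Summit.AtomisticToContinuum.Crystallization.Theses.BrittleRungDescent.LJBarlowRigidity :=
  LJBarlowRigidity_of stub_barlowWindows stub_stackingSelection stub_energyFromWindows

/-! ## By-name readings (certify the inlined signatures) -/

/-- The crux is literally `LocalBarlowOrder → Crystallization`. -/
example : Summit.AtomisticToContinuum.Crystallization.Theses.BrittleRungDescent.LJBarlowRigidity ↔ (LocalBarlowOrder → _root_.Crystallization) := Iff.rfl

/-- Stub 1 is `LocalBarlowOrder →` item 14292's decl, … -/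
example : ((∃ a : ℝ, 0 < a ∧ ∀ x : (N : ℕ) → (Fin N → EuclideanSpace ℝ (Fin 3)), (∀ N, Literature.MathematicalPhysics.StatisticalMechanics.IsGroundState Literature.MathematicalPhysics.StatisticalMechanics.lennardJones (x N)) → Filter.Tendsto (fun N : ℕ => (Nat.card {i : Fin N // ¬ ∀ j : Fin N, dist (x N i) (x N j) ≤ 4 * a → (((∀ l : Fin N, l ≠ j → a * (1 - 1 / 400) ≤ dist (x N j) (x N l) ∧ (dist (x N j) (x N l) ≤ a * (1 + 1 / 400) ∨ 63 / 50 * a ≤ dist (x N j) (x N l))) ∧ Nat.card {l : Fin N // l ≠ j ∧ dist (x N j) (x N l) ≤ a * (1 + 1 / 400)} = 12) ∧ ((∃ e : {k : Fin N // k ≠ j ∧ dist (x N j) (x N k) ≤ a * (1 + 1 / 400)} ≃ {q : EuclideanSpace ℝ (Fin 3) // q ∈ Literature.Geometry.DiscreteGeometry.fccKissingPattern}, ∀ k k' : {k : Fin N // k ≠ j ∧ dist (x N j) (x N k) ≤ a * (1 + 1 / 400)}, k ≠ k' → (dist (x N k.1) (x N k'.1) ≤ a * (1 + 1 / 400) ↔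 dist (e k).1 (e k').1 = 1)) ∨ (∃ e : {k : Fin N // k ≠ j ∧ dist (x N j) (x N k) ≤ a * (1 + 1 / 400)} ≃ {q : EuclideanSpace ℝ (Fin 3) // q ∈ Literature.Geometry.DiscreteGeometry.hcpKissingPattern}, ∀ k k' : {k : Fin N // k ≠ j ∧ dist (x N j) (x N k) ≤ a * (1 + 1 / 400)}, k ≠ k' → (dist (x N k.1) (x N k'.1) ≤ a * (1 + 1 / 400) ↔ dist (e k).1 (e k').1 = 1))))} : ℝ) / N) Filter.atTop (nhds 0)) → ∀ R ε : ℝ, 0 < R → 0 < ε → ε < 1 / 4 → ∀ x : (N : ℕ) → (Fin N → EuclideanSpace ℝ (Fin 3)), (∀ N, Literature.MathematicalPhysics.StatisticalMechanics.IsGroundState Literature.MathematicalPhysics.StatisticalMechanics.lennardJones (x N)) → Filter.Tendsto (fun N : ℕ => (Nat.card {i : Fin N // ¬ (∃ a h : ℝ, 1 / 2 < a ∧ a < 2 ∧ 1 / 2 < h ∧ h < 2 ∧ ∃ s : ℤ → ℤ, Literature.MathematicalPhysics.StatisticalMechanics.IsHaggSeq s ∧ ∃ z ∈ Literature.MathematicalPhysics.StatisticalMechanics.barlowStacking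 a h s, ∃ A : EuclideanSpace ℝ (Fin 3) →ₗᵢ[ℝ] EuclideanSpace ℝ (Fin 3), (∀ p ∈ Literature.MathematicalPhysics.StatisticalMechanics.barlowStacking a h s, dist p z ≤ R → ∃ j : Fin N, dist (x N j) (x N i + A (p - z)) ≤ ε) ∧ (∀ j : Fin N, dist (x N j) (x N i) ≤ R → ∃ p ∈ Literature.MathematicalPhysics.StatisticalMechanics.barlowStacking a h s, dist (x N j) (x N i + A (p - z)) ≤ ε))} : ℝ) / N) Filter.atTop (nhds 0)) ↔ (LocalBarlowOrder → Summit.AtomisticToContinuum.Crystallization.Theses.LaminarSixThreeThree.LaminarBarlowWindows) := Iff.rfl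

/-- … hence discharged by name the day item 14292 (`LaminarBarlowWindows`) closes. -/
example : Summit.AtomisticToContinuum.Crystallization.Theses.LaminarSixThreeThree.LaminarBarlowWindows → ((∃ a : ℝ, 0 < a ∧ ∀ x : (N : ℕ) → (Fin N → EuclideanSpace ℝ (Fin 3)), (∀ N, Literature.MathematicalPhysics.StatisticalMechanics.IsGroundState Literature.MathematicalPhysics.StatisticalMechanics.lennardJones (x N)) → Filter.Tendsto (fun N : ℕ => (Nat.card {i : Fin N // ¬ ∀ j : Fin N, dist (x N i) (x N j) ≤ 4 * a → (((∀ l : Fin N, l ≠ j → a * (1 - 1 / 400) ≤ dist (x N j) (x N l) ∧ (dist (x N j) (x N l) ≤ a * (1 + 1 / 400) ∨ 63 / 50 * a ≤ dist (x N j) (x N l))) ∧ Nat.card {l : Fin N // l ≠ j ∧ dist (x N j) (x N l) ≤ a * (1 + 1 / 400)} = 12) ∧ ((∃ e : {k : Fin N // k ≠ j ∧ dist (x N j) (x N k) ≤ a * (1 + 1 / 400)} ≃ {q : EuclideanSpace ℝ (Fin 3) // q ∈ Literature.Geometry.DiscreteGeometry.fccKissingPattern}, ∀ k k' : {k : Fin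 N // k ≠ j ∧ dist (x N j) (x N k) ≤ a * (1 + 1 / 400)}, k ≠ k' → (dist (x N k.1) (x N k'.1) ≤ a * (1 + 1 / 400) ↔ dist (e k).1 (e k').1 = 1)) ∨ (∃ e : {k : Fin N // k ≠ j ∧ dist (x N j) (x N k) ≤ a * (1 + 1 / 400)} ≃ {q : EuclideanSpace ℝ (Fin 3) // q ∈ Literature.Geometry.DiscreteGeometry.hcpKissingPattern}, ∀ k k' : {k : Fin N // k ≠ j ∧ dist (x N j) (x N k) ≤ a * (1 + 1 / 400)}, k ≠ k' → (dist (x N k.1) (x N k'.1) ≤ a * (1 + 1 / 400) ↔ dist (e k).1 (e k').1 = 1))))} : ℝ) / N) Filter.atTop (nhds 0)) → ∀ R ε : ℝ, 0 < R → 0 < ε → ε < 1 / 4 → ∀ x : (N : ℕ) → (Fin N → EuclideanSpace ℝ (Fin 3)), (∀ N, Literature.MathematicalPhysics.StatisticalMechanics.IsGroundState Literature.MathematicalPhysics.StatisticalMechanics.lennardJones (x N)) → Filter.Tendsto (fun N : ℕ => (Nat.card {i : Fin N // ¬ (∃ a h : ℝ, 1 / 2 < a ∧ a < 2 ∧ 1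 / 2 < h ∧ h < 2 ∧ ∃ s : ℤ → ℤ, Literature.MathematicalPhysics.StatisticalMechanics.IsHaggSeq s ∧ ∃ z ∈ Literature.MathematicalPhysics.StatisticalMechanics.barlowStacking a h s, ∃ A : EuclideanSpace ℝ (Fin 3) →ₗᵢ[ℝ] EuclideanSpace ℝ (Fin 3), (∀ p ∈ Literature.MathematicalPhysics.StatisticalMechanics.barlowStacking a h s, dist p z ≤ R → ∃ j : Fin N, dist (x N j) (x N i + A (p - z)) ≤ ε) ∧ (∀ j : Fin N, dist (x N j) (x N i) ≤ R → ∃ p ∈ Literature.MathematicalPhysics.StatisticalMechanics.barlowStacking a h s, dist (x N j) (x N i + A (p - z)) ≤ ε))} : ℝ) / N) Filter.atTop (nhds 0)) :=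
  fun h _ => h

/-- Stub 2 is `LocalBarlowOrder → TwoScaleStackingSelection`. -/
example : ((∃ a : ℝ, 0 < a ∧ ∀ x : (N : ℕ) → (Fin N → EuclideanSpace ℝ (Fin 3)), (∀ N, Literature.MathematicalPhysics.StatisticalMechanics.IsGroundState Literature.MathematicalPhysics.StatisticalMechanics.lennardJones (x N)) → Filter.Tendsto (fun N : ℕ => (Nat.card {i : Fin N // ¬ ∀ j : Fin N, dist (x N i) (x N j) ≤ 4 * a → (((∀ l : Fin N, l ≠ j → a * (1 - 1 / 400) ≤ dist (x N j) (x N l) ∧ (dist (x N j) (x N l) ≤ a * (1 + 1 / 400) ∨ 63 / 50 * a ≤ dist (x N j) (x N l))) ∧ Nat.card {l : Fin N // l ≠ j ∧ dist (x N j) (x N l) ≤ a * (1 + 1 / 400)} = 12) ∧ ((∃ e : {k : Fin N // k ≠ j ∧ dist (x N j) (x N k) ≤ a * (1 + 1 / 400)} ≃ {q : EuclideanSpace ℝ (Fin 3) // q ∈ Literature.Geometry.DiscreteGeometry.fccKissingPattern}, ∀ k k' : {k : Fin N // k ≠ j ∧ dist (x N j) (x N k) ≤ a * (1 + 1 / 400)},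 k ≠ k' → (dist (x N k.1) (x N k'.1) ≤ a * (1 + 1 / 400) ↔ dist (e k).1 (e k').1 = 1)) ∨ (∃ e : {k : Fin N // k ≠ j ∧ dist (x N j) (x N k) ≤ a * (1 + 1 / 400)} ≃ {q : EuclideanSpace ℝ (Fin 3) // q ∈ Literature.Geometry.DiscreteGeometry.hcpKissingPattern}, ∀ k k' : {k : Fin N // k ≠ j ∧ dist (x N j) (x N k) ≤ a * (1 + 1 / 400)}, k ≠ k' → (dist (x N k.1) (x N k'.1) ≤ a * (1 + 1 / 400) ↔ dist (e k).1 (e k').1 = 1))))} : ℝ) / N) Filter.atTop (nhds 0)) → ∃ P : Literature.MathematicalPhysics.StatisticalMechanics.PeriodicConfiguration 3, ∀ R ε : ℝ, 0 < R → 0 < ε → ∃ R' ε' : ℝ, 0 < R' ∧ 0 < ε' ∧ ε' < 1 / 4 ∧ ∀ x : (N : ℕ) → (Fin N → EuclideanSpace ℝ (Fin 3)), (∀ N, Literature.MathematicalPhysics.StatisticalMechanics.IsGroundState Literature.MathematicalPhysics.StatisticalMechanics.lennardJones (x N)) → Filter.Tendsto (fun N : ℕ => (Nat.card {i : Fin N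 // (∃ a h : ℝ, 1 / 2 < a ∧ a < 2 ∧ 1 / 2 < h ∧ h < 2 ∧ ∃ s : ℤ → ℤ, Literature.MathematicalPhysics.StatisticalMechanics.IsHaggSeq s ∧ ∃ z ∈ Literature.MathematicalPhysics.StatisticalMechanics.barlowStacking a h s, ∃ A : EuclideanSpace ℝ (Fin 3) →ₗᵢ[ℝ] EuclideanSpace ℝ (Fin 3), (∀ p ∈ Literature.MathematicalPhysics.StatisticalMechanics.barlowStacking a h s, dist p z ≤ R' → ∃ j : Fin N, dist (x N j) (x N i + A (p - z)) ≤ ε') ∧ (∀ j : Fin N, dist (x N j) (x N i) ≤ R' → ∃ p ∈ Literature.MathematicalPhysics.StatisticalMechanics.barlowStacking a h s, dist (x N j) (x N i + A (p - z)) ≤ ε')) ∧ ¬ (∃ A : EuclideanSpace ℝ (Fin 3) →ₗᵢ[ℝ] EuclideanSpace ℝ (Fin 3), ∃ p ∈ P.points, (∀ q ∈ P.points, dist q p ≤ R → ∃ j : Fin N, dist (x N j) (x N i + A (q - p)) ≤ ε) ∧ (∀ j : Fin N, dist (x N j) (x N i) ≤ R → ∃ q ∈ P.points, dist (x N j) (x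 N i + A (q - p)) ≤ ε))} : ℝ) / N) Filter.atTop (nhds 0)) ↔ (LocalBarlowOrder → TwoScaleStackingSelection) := Iff.rfl

/-- Stub 3 is `EnergyFromWindows`. -/
example : (∀ P : Literature.MathematicalPhysics.StatisticalMechanics.PeriodicConfiguration 3, (∀ R ε : ℝ, 0 < R → 0 < ε → ∀ x : (N : ℕ) → (Fin N → EuclideanSpace ℝ (Fin 3)), (∀ N, Literature.MathematicalPhysics.StatisticalMechanics.IsGroundState Literature.MathematicalPhysics.StatisticalMechanics.lennardJones (x N)) → Filter.Tendsto (fun N : ℕ => (Nat.card {i : Fin N // ¬ ∃ A : EuclideanSpace ℝ (Fin 3) →ₗᵢ[ℝ] EuclideanSpace ℝ (Fin 3), ∃ p ∈ P.points, (∀ q ∈ P.points, dist q p ≤ R → ∃ j : Fin N, dist (x N j) (x N i + A (q - p)) ≤ ε) ∧ (∀ j : Fin N, dist (x N j) (x N i) ≤ R → ∃ q ∈ P.points, dist (x N j) (x N i + A (q - p)) ≤ ε)} : ℝ) / N) Filter.atTop (nhds 0)) → Filter.Tendsto (fun N : ℕ => Literature.MathematicalPhysics.StatisticalMechanics.groundStateEnergy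 Literature.MathematicalPhysics.StatisticalMechanics.lennardJones 3 N / N) Filter.atTop (nhds (P.energyPerParticle Literature.MathematicalPhysics.StatisticalMechanics.lennardJones))) ↔ EnergyFromWindows := Iff.rfl

/-- The named statements imply the crux (by-name form of `LJBarlowRigidity_of`). -/
example : (LocalBarlowOrder → Summit.AtomisticToContinuum.Crystallization.Theses.LaminarSixThreeThree.LaminarBarlowWindows) → (LocalBarlowOrder → TwoScaleStackingSelection) →
    EnergyFromWindows → Summit.AtomisticToContinuum.Crystallization.Theses.BrittleRungDescent.LJBarlowRigidity :=
  fun h1 h2 h3 => LJBarlowRigidity_of h1 h2 h3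

end Summit.AtomisticToContinuum.Crystallization.Cruxes.LJBarlowRigidity.Birth
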